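import Summits.Ventures.Crystal3D.Kissing125.GSearchDefs2
import Summits.Ventures.Crystal3D.Kissing125.GSearchNode2
import Summits.Ventures.Crystal3D.Kissing125.GSearchRoot1
import HarnessLib

/-!
# Root normalisation and the conclusion from the parts, κ-generic — part 2/4

HONEST FRAMING (cell pub-crystal3d, K-path at `h = 5/4`, V4 = κ as an explicit parameter): this is NOT a result printed
by Hales; it is his METHOD (arXiv:1209.6043, Theorem 3 + Lemmas 7–10, in the tree's form of a verified interval-arithmetic
growth search, `Literature/…/KissingSearch*.lean`) with the largest long-side cosine `κ` made an EXPLICIT PARAMETER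
(`κ : Kappa`, carrying the two numeric facts the soundness proof uses: `-1/2 ≤ κ`, `κ < 1/4`).  Only the declarations
whose statement depends on `κ` are declared here (namespace `…Kissing125.GSearch`, the tree's short names, no renames);
every κ-free helper is the landed K25 copy (`…Kissing125.KissingSearch.*`) and every κ-free lemma is cited from the tree
(PRIVATE per-file citation aliases; `GSearchTransport.lean` holds `toT : St → tree St` and the transport equalities).  The K25
instance is `κ25 = ⟨7/32, …⟩`; `GSearchBridge.lean` identifies the generic checker at
`κ25` with the landed `Kissing125.KissingSearch.checkPart`, so the landed run files are consumed unchanged.  Generated by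
`HOME/lean/kissing125/v4-prep/gen/mkgen.py`; nothing here is asserted about GAP(1.26) or any census.

THIS FILE: the κ-tainted declarations of `Literature/Geometry/DiscreteGeometry/KissingSearchRoot.lean` (part 2 of 4), with `κ : Kappa` threaded; κ-free declarations of that file are NOT re-declared publicly (the κ-free helpers are the landed K25 copies; the κ-free tree lemmas used by the proofs are cited through PRIVATE aliases at the top of the file).

## References
* T. C. Hales, *A proof of Fejes Tóth's conjecture on sphere packings with kissing number twelve*,
  arXiv:1209.6043 (2012): Definition 1, Theorem 2, Theorem 3, Lemmas 7–10. [`Hales2012`]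
* R. E. Moore, *Interval Analysis* (1966), Theorem 3.1, §4.4. [`Moore1966`]
-/

namespace Summit.Ventures.Crystal3D.Kissing125

open Literature.Geometry.DiscreteGeometry
open Summit.Ventures.Crystal3D.Kissing125.KissingSearch

namespace GSearch

open Real Literature.Analysis.ValidatedNumerics KissingLP NonemptyInterval Finset

variable {κ : Kappa}

/-! ### κ-free tree lemmas used below, read over the K25 copies (PRIVATE citation aliases; the public
surface of this file is κ-generic only) -/

/-- K25 reading of the tree lemma `card_relab` (κ-free; proof = citation of the tree lemma). [folklore] -/
private theorem card_relab (σ : Equiv.Perm ℕ) (t : Finset ℕ) : #(relab σ t) = #t :=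
  Literature.Geometry.DiscreteGeometry.KissingSearch.card_relab σ t

/-- K25 reading of the tree lemma `exists_common_of_inter_two` (κ-free; proof = citation of the tree lemma). [folklore] -/
private theorem exists_common_of_inter_two {t t' : Finset ℕ} (v : ℕ)
  (h2 : #(t ∩ t') = 2) : ∃ x, x ≠ v ∧ x ∈ t ∧ x ∈ t' :=
  Literature.Geometry.DiscreteGeometry.KissingSearch.exists_common_of_inter_two v h2

/-- K25 reading of the tree lemma `symm_lt_iff` (κ-free; proof = citation of the tree lemma). [folklore] -/
private theorem symm_lt_iff (σ : Equiv.Perm ℕ)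
  (hσ : ∀ (a : ℕ), (σ : ℕ → ℕ) a < 12 ↔ a < 12) (a : ℕ) : (Equiv.symm σ : ℕ → ℕ) a < 12 ↔ a < 12 :=
  Literature.Geometry.DiscreteGeometry.KissingSearch.symm_lt_iff σ hσ a


section RootVertex
variable (M : KConf κ)
/-- **Existence of the good configuration.** [cite: Hales2012, proof of Theorem 3] -/
theorem KConf.exists_good (M : KConf κ) : ∃ v₀ p q p₃ p₄, M.Good v₀ p q p₃ p₄ := by
  classical
  obtain ⟨v₀, hv₀, hc4, hl1⟩ := M.exists_root_vertex
  -- pairwise form of "at most one long side"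
  have hpair : ∀ u w, ({v₀, u} : Finset ℕ) ∈ M.longSides → ({v₀, w} : Finset ℕ) ∈ M.longSides → u = w := by
    intro u w hu hw
    have mem : ∀ {x}, ({v₀, x} : Finset ℕ) ∈ M.longSides → x ∈ M.longSpokes v₀ := by
      intro x hx
      unfold KConf.longSpokes
      rw [Finset.mem_filter, Finset.mem_range]
      refine ⟨?_, hx⟩
      unfold KConf.longSides at hx
      rw [Finset.mem_filter, M.mem_sides] at hx
      obtain ⟨⟨-, t, ht, hsub⟩, -⟩ := hx
      exact (M.mem_T t ht).2 x (hsub (by simp))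
    exact Finset.card_le_one.1 hl1 u (mem hu) w (mem hw)
  -- the triangles at `v₀`; spokes
  -- a contact `p` of `v₀` (there are four)
  have hne : (M.contacts v₀).Nonempty := by rw [← Finset.card_pos, hc4]; norm_num
  obtain ⟨p₀, hp₀⟩ := hne
  unfold KConf.contacts at hp₀
  rw [Finset.mem_filter, Finset.mem_range] at hp₀
  obtain ⟨hp₀12, hp₀v, hgp₀⟩ := hp₀
  -- a triangle through `{v₀, p₀}`
  obtain ⟨t₁, ht₁, hv₁, hp₁⟩ := M.contact_side v₀ p₀ hv₀ hp₀12 (Ne.symm hp₀v) hgp₀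
  obtain ⟨q₁, hq₁12, hq₁v, hq₁p, rfl⟩ := M.exists_third_of_mem ht₁ hv₁ hp₁ (Ne.symm hp₀v)
  -- among the two triangles on the contact spoke `{v₀, p₀}`, one has its other spoke a contact:
  -- otherwise both other spokes are long sides through `v₀`, hence equal, hence the same triangle
  obtain ⟨t₂, ht₂, ht₂ne, hv₂, hp₂⟩ := M.exists_other ht₁ (show v₀ ∈ ({v₀, p₀, q₁} : Finset ℕ) by simp)
    (show p₀ ∈ ({v₀, p₀, q₁} : Finset ℕ) by simp) (Ne.symm hp₀v)
  obtain ⟨q₂, hq₂12, hq₂v, hq₂p, rfl⟩ := M.exists_third_of_mem ht₂ hv₂ hp₂ (Ne.symm hp₀v)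
  have long_of : ∀ {x : ℕ} {t : Finset ℕ}, t ∈ M.T → v₀ ∈ t → x ∈ t → x ≠ v₀ → x < 12 → M.g v₀ x ≠ 1 / 2 →
      ({v₀, x} : Finset ℕ) ∈ M.longSides := by
    intro x t ht hvt hxt hxv hx12 hg
    unfold KConf.longSides
    rw [Finset.mem_filter, M.mem_sides]
    refine ⟨⟨by rw [Finset.card_pair (Ne.symm hxv)], t, ht, ?_⟩, v₀, by simp, x, by simp, Ne.symm hxv, hg⟩
    intro y hy; simp only [Finset.mem_insert, Finset.mem_singleton] at hy
    rcases hy with rfl | rfl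
    · exact hvt
    · exact hxt
  -- choose `(p, q)` with both spokes contacts
  obtain ⟨p, q, hp12, hq12, hpv, hqv, hpq, hgp, hgq, hT⟩ : ∃ p q, p < 12 ∧ q < 12 ∧ p ≠ v₀ ∧ q ≠ v₀ ∧ p ≠ q ∧
      M.g v₀ p = 1 / 2 ∧ M.g v₀ q = 1 / 2 ∧ ({v₀, p, q} : Finset ℕ) ∈ M.T := by
    by_cases hg1 : M.g v₀ q₁ = 1 / 2
    · exact ⟨p₀, q₁, hp₀12, hq₁12, hp₀v, hq₁v, Ne.symm hq₁p, hgp₀, hg1, ht₁⟩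
    · by_cases hg2 : M.g v₀ q₂ = 1 / 2
      · exact ⟨p₀, q₂, hp₀12, hq₂12, hp₀v, hq₂v, Ne.symm hq₂p, hgp₀, hg2, ht₂⟩
      · exfalso
        have l1 := long_of ht₁ (by simp) (by simp) hq₁v hq₁12 hg1
        have l2 := long_of ht₂ (by simp) (by simp) hq₂v hq₂12 hg2
        have := hpair _ _ l1 l2
        exact ht₂ne (by rw [this])
  -- the other triangles on the two spokes
  obtain ⟨t₃, ht₃, ht₃ne, hv₃, hp₃⟩ := M.exists_other hT (show v₀ ∈ ({v₀, p, q} : Finset ℕ) by simp)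
    (show p ∈ ({v₀, p, q} : Finset ℕ) by simp) (Ne.symm hpv)
  obtain ⟨p₃, hp₃12, hp₃v, hp₃p, rfl⟩ := M.exists_third_of_mem ht₃ hv₃ hp₃ (Ne.symm hpv)
  obtain ⟨t₄, ht₄, ht₄ne, hv₄, hq₄⟩ := M.exists_other hT (show v₀ ∈ ({v₀, p, q} : Finset ℕ) by simp)
    (show q ∈ ({v₀, p, q} : Finset ℕ) by simp) (Ne.symm hqv)
  obtain ⟨p₄, hp₄12, hp₄v, hp₄q, rfl⟩ := M.exists_third_of_mem ht₄ hv₄ hq₄ (Ne.symm hqv)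
  have hp₃q : p₃ ≠ q := by rintro rfl; exact ht₃ne rfl
  have hp₄p : p₄ ≠ p := by
    rintro rfl; apply ht₄ne; ext x; simp only [Finset.mem_insert, Finset.mem_singleton]; tauto
  -- `p₃ ≠ p₄`: otherwise the three triangles are all the triangles at `v₀`, leaving three spokes
  have hp₃p₄ : p₃ ≠ p₄ := by
    intro e
    subst e
    -- the set of the three triangles is closed under side-sharing at `v₀`
    set A : Finset (Finset ℕ) := {{v₀, p, q}, {v₀, p, p₃}, {v₀, q, p₃}} with hA
    have hAsub : A ⊆ M.T.filter fun t => v₀ ∈ t := by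
      intro t ht
      rw [hA] at ht
      simp only [Finset.mem_insert, Finset.mem_singleton] at ht
      rw [Finset.mem_filter]
      rcases ht with rfl | rfl | rfl
      · exact ⟨hT, by simp⟩
      · exact ⟨ht₃, by simp⟩
      · exact ⟨ht₄, by simp⟩
    have hAne : A.Nonempty := ⟨{v₀, p, q}, by rw [hA]; exact Finset.mem_insert_self _ _⟩
    -- the two triangles on each of the three spokes are in `A`
    have onSpoke : ∀ {x : ℕ}, x ≠ v₀ → ∀ (ta tb : Finset ℕ), ta ∈ M.T → tb ∈ M.T → ta ≠ tb →
        v₀ ∈ ta → x ∈ ta → v₀ ∈ tb → x ∈ tb → ta ∈ A → tb ∈ A →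
        ∀ t' ∈ M.T, v₀ ∈ t' → x ∈ t' → t' ∈ A := by
      intro x hxv ta tb hta htb hne hva hxa hvb hxb haA hbA t' ht' hv' hx'
      have h2 := M.two ta hta v₀ hva x hxa (Ne.symm hxv)
      have hsub : ({ta, tb} : Finset (Finset ℕ)) ⊆ M.T.filter (fun t => v₀ ∈ t ∧ x ∈ t) := by
        intro t ht; simp only [Finset.mem_insert, Finset.mem_singleton] at ht
        rw [Finset.mem_filter]
        rcases ht with rfl | rfl
        · exact ⟨hta, hva, hxa⟩
        · exact ⟨htb, hvb, hxb⟩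
      have heq := Finset.eq_of_subset_of_card_le hsub (by rw [h2, Finset.card_pair hne])
      have : t' ∈ M.T.filter (fun t => v₀ ∈ t ∧ x ∈ t) := Finset.mem_filter.2 ⟨ht', hv', hx'⟩
      rw [← heq] at this
      simp only [Finset.mem_insert, Finset.mem_singleton] at this
      rcases this with rfl | rfl
      · exact haA
      · exact hbA
    have mA1 : ({v₀, p, q} : Finset ℕ) ∈ A := by rw [hA]; simp
    have mA2 : ({v₀, p, p₃} : Finset ℕ) ∈ A := by rw [hA]; simp
    have mA3 : ({v₀, q, p₃} : Finset ℕ) ∈ A := by rw [hA]; simp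
    have ne12 : ({v₀, p, q} : Finset ℕ) ≠ {v₀, p, p₃} := fun e => ht₃ne e.symm
    have ne13 : ({v₀, p, q} : Finset ℕ) ≠ {v₀, q, p₃} := fun e => ht₄ne e.symm
    have ne23 : ({v₀, p, p₃} : Finset ℕ) ≠ {v₀, q, p₃} := by
      intro e
      have : p ∈ ({v₀, q, p₃} : Finset ℕ) := by rw [← e]; simp
      simp only [Finset.mem_insert, Finset.mem_singleton] at this
      rcases this with h | h | h
      · exact hpv h
      · exact hpq h
      · exact hp₃p h.symm
    have hcl : ∀ t ∈ A, ∀ t' ∈ M.T, v₀ ∈ t' → (t ∩ t').card = 2 → t' ∈ A := by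
      intro t ht t' ht' hv' h2
      obtain ⟨x, hxv, hx, hx'⟩ := exists_common_of_inter_two v₀ h2
      rw [hA] at ht
      simp only [Finset.mem_insert, Finset.mem_singleton] at ht
      rcases ht with rfl | rfl | rfl
      · simp only [Finset.mem_insert, Finset.mem_singleton] at hx
        rcases hx with h | rfl | rfl
        · exact absurd h hxv
        · exact onSpoke hxv _ _ hT ht₃ ne12 (by simp) (by simp) (by simp) (by simp) mA1 mA2 t' ht' hv' hx'
        · exact onSpoke hxv _ _ hT ht₄ ne13 (by simp) (by simp) (by simp) (by simp) mA1 mA3 t' ht' hv' hx'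
      · simp only [Finset.mem_insert, Finset.mem_singleton] at hx
        rcases hx with h | rfl | rfl
        · exact absurd h hxv
        · exact onSpoke hxv _ _ hT ht₃ ne12 (by simp) (by simp) (by simp) (by simp) mA1 mA2 t' ht' hv' hx'
        · exact onSpoke hxv _ _ ht₃ ht₄ ne23 (by simp) (by simp) (by simp) (by simp) mA2 mA3 t' ht' hv' hx'
      · simp only [Finset.mem_insert, Finset.mem_singleton] at hx
        rcases hx with h | rfl | rfl
        · exact absurd h hxv
        · exact onSpoke hxv _ _ hT ht₄ ne13 (by simp) (by simp) (by simp) (by simp) mA1 mA3 t' ht' hv' hx'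
        · exact onSpoke hxv _ _ ht₃ ht₄ ne23 (by simp) (by simp) (by simp) (by simp) mA2 mA3 t' ht' hv' hx'
    have hAeq := M.link v₀ hv₀ A hAsub hAne hcl
    -- the four contacts of `v₀` are spokes, i.e. in `{p, q, p₃}`
    have spokes : ∀ u ∈ M.contacts v₀, u ∈ ({p, q, p₃} : Finset ℕ) := by
      intro u hu
      unfold KConf.contacts at hu
      rw [Finset.mem_filter, Finset.mem_range] at hu
      obtain ⟨hu12, huv, hgu⟩ := hu
      obtain ⟨t, ht, hvt, hut⟩ := M.contact_side v₀ u hv₀ hu12 (Ne.symm huv) hgu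
      have : t ∈ A := by rw [hAeq, Finset.mem_filter]; exact ⟨ht, hvt⟩
      rw [hA] at this
      simp only [Finset.mem_insert, Finset.mem_singleton] at this
      rcases this with rfl | rfl | rfl <;> simp only [Finset.mem_insert, Finset.mem_singleton] at hut ⊢ <;> omega
    have := Finset.card_le_card (show M.contacts v₀ ⊆ ({p, q, p₃} : Finset ℕ) from spokes)
    rw [hc4] at this
    have h3 : (({p, q, p₃} : Finset ℕ)).card ≤ 3 := Finset.card_le_three
    omega
  exact ⟨v₀, p, q, p₃, p₄, hv₀, hp12, hq12, hp₃12, hp₄12, Ne.symm hpv, Ne.symm hqv, Ne.symm hp₃v, Ne.symm hp₄v, hpq,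
    Ne.symm hp₃p, Ne.symm hp₄p, Ne.symm hp₃q |>.symm |> Ne.symm, Ne.symm hp₄q, hp₃p₄, hgp, hgq, hT, ht₃, ht₄, hc4, hpair⟩

end RootVertex

/-! ### Part B. Transport of the good configuration; normalisation to the labels `0 … 4` -/

section Transport

variable (M : KConf κ)

/-- Long sides of the relabelled structure. [folklore] -/
theorem KConf.mem_longSides_relabel (M : KConf κ) (σ : Equiv.Perm ℕ) (hσ : ∀ a, σ a < 12 ↔ a < 12) {e : Finset ℕ} :
    e ∈ (M.relabel σ hσ).longSides ↔ relab σ.symm e ∈ M.longSides := by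
  unfold KConf.longSides
  rw [Finset.mem_filter, Finset.mem_filter, KConf.mem_sides, KConf.mem_sides]
  constructor
  · rintro ⟨⟨hc, t, ht, hsub⟩, p, hp, q, hq, hpq, hg⟩
    change t ∈ M.T.image (relab σ) at ht
    rw [Finset.mem_image] at ht
    obtain ⟨t₀, ht₀, rfl⟩ := ht
    refine ⟨⟨by rw [card_relab, hc], t₀, ht₀, fun x hx => ?_⟩, σ.symm p, (mem_relab_iff σ.symm).2 (by simpa using hp),
      σ.symm q, (mem_relab_iff σ.symm).2 (by simpa using hq), fun e => hpq (σ.symm.injective e), hg⟩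
    rw [mem_relab_iff] at hx
    simp only [Equiv.symm_symm] at hx
    have := hsub hx
    rw [mem_relab_iff] at this
    simpa using this
  · rintro ⟨⟨hc, t₀, ht₀, hsub⟩, p, hp, q, hq, hpq, hg⟩
    rw [card_relab] at hc
    rw [mem_relab_iff] at hp hq
    simp only [Equiv.symm_symm] at hp hq
    refine ⟨⟨hc, relab σ t₀, Finset.mem_image_of_mem _ ht₀, fun x hx => ?_⟩, σ p, hp, σ q, hq,
      fun e => hpq (σ.injective e), ?_⟩
    · rw [mem_relab_iff]
      exact hsub ((mem_relab_iff σ.symm).2 (by simpa using hx))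
    · show M.g (σ.symm (σ p)) (σ.symm (σ q)) ≠ 1 / 2
      simpa using hg

/-- **Transport of the good configuration along a relabelling.** [folklore] -/
theorem KConf.good_relabel (M : KConf κ) (σ : Equiv.Perm ℕ) (hσ : ∀ a, σ a < 12 ↔ a < 12) {v₀ p q p₃ p₄ : ℕ}
    (G : M.Good v₀ p q p₃ p₄) : (M.relabel σ hσ).Good (σ v₀) (σ p) (σ q) (σ p₃) (σ p₄) := by
  classical
  obtain ⟨hv, hp, hq, h3, h4, n1, n2, n3, n4, n5, n6, n7, n8, n9, n10, g1, g2, T1, T2, T3, hc4, hpair⟩ := G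
  have inj := σ.injective
  have gg : ∀ a b, (M.relabel σ hσ).g (σ a) (σ b) = M.g a b := fun a b => by
    show M.g (σ.symm (σ a)) (σ.symm (σ b)) = M.g a b; simp
  have tt : ∀ a b c, ({a, b, c} : Finset ℕ) ∈ M.T → ({σ a, σ b, σ c} : Finset ℕ) ∈ (M.relabel σ hσ).T := by
    intro a b c h
    show ({σ a, σ b, σ c} : Finset ℕ) ∈ M.T.image (relab σ)
    rw [Finset.mem_image]
    exact ⟨{a, b, c}, h, by unfold relab; simp [Finset.image_insert, Finset.image_singleton]⟩
  refine ⟨(hσ _).2 hv, (hσ _).2 hp, (hσ _).2 hq, (hσ _).2 h3, (hσ _).2 h4, inj.ne n1, inj.ne n2, inj.ne n3, inj.ne n4,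
    inj.ne n5, inj.ne n6, inj.ne n7, inj.ne n8, inj.ne n9, inj.ne n10, by rw [gg]; exact g1, by rw [gg]; exact g2,
    tt _ _ _ T1, tt _ _ _ T2, tt _ _ _ T3, ?_, ?_⟩
  · rw [← hc4]
    symm
    refine Finset.card_bij (fun u _ => σ u) ?_ ?_ ?_
    · intro u hu
      unfold KConf.contacts at hu ⊢
      rw [Finset.mem_filter, Finset.mem_range] at hu ⊢
      exact ⟨(hσ u).2 hu.1, inj.ne hu.2.1, by rw [gg]; exact hu.2.2⟩
    · intro u _ u' _ e; exact inj e
    · intro w hw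
      unfold KConf.contacts at hw
      rw [Finset.mem_filter, Finset.mem_range] at hw
      refine ⟨σ.symm w, ?_, by simp⟩
      unfold KConf.contacts
      rw [Finset.mem_filter, Finset.mem_range, symm_lt_iff σ hσ]
      refine ⟨hw.1, fun e => hw.2.1 (by rw [← e]; simp), ?_⟩
      have := hw.2.2
      change M.g (σ.symm (σ v₀)) (σ.symm w) = 1 / 2 at this
      simpa using this
  · intro u w hu hw
    rw [KConf.mem_longSides_relabel] at hu hw
    unfold relab at hu hw
    simp only [Finset.image_insert, Finset.image_singleton, Equiv.symm_apply_apply] at hu hw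
    have := hpair _ _ hu hw
    exact σ.symm.injective this

/-- Swapping the roles `(p, p₃) ↔ (q, p₄)`. [folklore] -/
theorem KConf.good_swap_roles (M : KConf κ) {v₀ p q p₃ p₄ : ℕ} (G : M.Good v₀ p q p₃ p₄) : M.Good v₀ q p p₄ p₃ := by
  obtain ⟨hv, hp, hq, h3, h4, n1, n2, n3, n4, n5, n6, n7, n8, n9, n10, g1, g2, T1, T2, T3, hc4, hpair⟩ := G
  refine ⟨hv, hq, hp, h4, h3, n2, n1, n4, n3, n5.symm, n9, n8, n7, n6, n10.symm, g2, g1, ?_, T3, T2, hc4, hpair⟩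
  have : ({v₀, q, p} : Finset ℕ) = {v₀, p, q} := by
    ext x; simp only [Finset.mem_insert, Finset.mem_singleton]; tauto
  rw [this]; exact T1

/-- The four-contacts part of `Good`. [folklore] -/
theorem KConf.Good.contacts_eq (M : KConf κ) {v₀ p q p₃ p₄ : ℕ} (G : M.Good v₀ p q p₃ p₄) : (M.contacts v₀).card = 4 :=
  G.2.2.2.2.2.2.2.2.2.2.2.2.2.2.2.2.2.2.2.2.1

/-- The one-long-side part of `Good`. [folklore] -/
theorem KConf.Good.longSides_eq (M : KConf κ) {v₀ p q p₃ p₄ : ℕ} (G : M.Good v₀ p q p₃ p₄) :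
    ∀ u w, ({v₀, u} : Finset ℕ) ∈ M.longSides → ({v₀, w} : Finset ℕ) ∈ M.longSides → u = w :=
  G.2.2.2.2.2.2.2.2.2.2.2.2.2.2.2.2.2.2.2.2.2

end Transport

end GSearch

end Summit.Ventures.Crystal3D.Kissing125
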